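/-
Origin: expansion seat `prover-pub-hodgecm-mc-sinst-1-g9-0`, handover #1238 2026-08-20T20:38Z md5 4d938343702e (403 l.; NEW additive leaf, ns HodgeCM.Model.ThetaSpace / HodgeCM.Model / HodgeCM.Model.ThetaAdelicSide; imports #1236 + PKG Model/ArchSideLevel only; §1 `adelicThetaSpan_mono`, `adelicThetaSpan_le_biSup_singleton`/`biSup_adelicThetaSpan_singleton_eq` (character decomposition), `adelicThetaSpanSat KΓ 𝓕` (span over strict situations SATURATED at KΓ) + `_le_adelicThetaSpan`/`_anti`/`_bot`, `rightShift_eq_self_of_mem_adelicThetaSpanSat` (right-KΓ-invariance on the nose), `exists_mem_adelicThetaSpanSat_coe_eq_comp` (thetaSpaceSatOf = restrictions of saturated forms), `adelicThetaRepHom e he 𝓕` (pull-back along any hom into G_U(𝔸) centralising ιinf) + `_apply_eq_self`, `exists_sat_lift_of_mem_thetaClasses`; §2 `finToG V hV : V.adelicFin →* G_U(𝔸)` + `_eq_toLatticeModelG`/`_mem_archFinOf`/`commute_finToG_archInfOf`/`finToG_mem_satLevelRegimeOf`, `ThetaAdelicSide.finToG_mem_Gfin`/`commute_finToG_ιinf`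 (any S); §3 `ThetaAdelicSide.adelicThetaRepFin hV k κ₁ τ₁ 𝓕 : Representation ℂ ↥V.adelicFin (adelicThetaSpan (S.P k) S.ιinf κ₁ τ₁ 𝓕)` + `adelicThetaRepFin_apply_eq_self_of_mem` (level-K saturated forms are K-fixed); §4 `exists_fixed_adelic_lift_of_mem_thetaOf` (at the pin, regime: every ω ∈ Θ_k(Γ) of the END STATE is a (1,0)-class whose holomorphic pull-back is F ∘ S.ιinf for an F of the slot's module saturated at satLevelRegimeOf V h Γ.K, fixed by Γ.K); NAME LIST: HodgeCM.Model.ThetaSpace.rightShift_eq_self_of_mem_adelicThetaSpanSat · HodgeCM.Model.ThetaAdelicSide.adelicThetaRepFin_apply_eq_self_of_mem · HodgeCM.Model.exists_fixed_adelic_lift_of_mem_thetaOf) (`HOME/mc/pub-hodgecm-mc-sinst-1-g9/stage/HodgeCM/Model/AdelicThetaModuleFin.lean`, md5 4d938343702e, 403 lines);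
landed by the gen-26 packager (p-g26) in gate run 63 as `HodgeCM/Model/AdelicThetaModuleFin.lean` (verbatim).
-/
/-
Copyright (c) 2026 the pub-hodgecm formalisation cell (harness21).  New file, not vendored.
Origin: session prover-pub-hodgecm-mc-sinst-1-g9-0 (unit pub-hodgecm-mc-sinst-1-g9, S-INSTANCE CONSTRUCTOR gen 9; (J4) side of the
(J-Liu-Θ) junction behind E's row 9 `hΘ`), 2026-08-20.
Intended final place: `HodgeCM/Model/AdelicThetaModuleFin.lean` (NEW additive model-layer leaf; imports sinst-1's
`HodgeCM.Model.AdelicThetaModule` and period-1's `HodgeCM.Model.ArchSideLevel` only; nothing imports it; drop alone on bounce).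
-/
import Summits.HodgeConjecture.HodgeCM.Model.AdelicThetaModule
import Summits.HodgeConjecture.HodgeCM.Model.ArchSideLevel

set_option autoImplicit false

/-!
# The adèlic theta module of a slot as a representation of `U(V)(𝔸_f)`; level-`K` theta forms are its `K`-fixed vectors

The (J3) dictionary of row 9 (axioms-1, `LiuDictionary`) is a `ℂ[G]`-module picture with `G = ↥V.adelicFin = U(V)(𝔸_{L⁺,f})`
(binder-1's tower `towerLevel`/`TowerCarrier` is indexed and acted on by `V.adelicFin`).  sinst-1's `AdelicThetaModule` gives
the adèlic theta module `adelicThetaSpan P ιinf κ₁ τ₁ 𝓕 ≤ (G_U(𝔸) → W)` of a pair datum with its right-translation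
representation of any subgroup of `G_U(𝔸)` centralising the archimedean component.  This leaf supplies what the junction's
`hIso` reads on the (J4) side:

§1 (any pair datum `P`, any `G_U(𝔸)`):
* `adelicThetaSpan_mono` and **`adelicThetaSpan_le_biSup_singleton`** — the module with weight functions `𝓕` is the sum of
  the single-character modules `adelicThetaSpan … {f}`, `f ∈ 𝓕` (one [Liu21] triple `(μ, ε, χ)` per character);
* **`adelicThetaSpanSat KΓ 𝓕`** — the span of the theta forms of the strict situations SATURATED at `KΓ ≤ G_U(𝔸)`
  (theta-3's `IsSaturated`/`IsStrict`), `≤ adelicThetaSpan`, antitone in `KΓ`, and **`rightShift_eq_self_of_mem_adelicThetaSpanSat`**: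
  its elements are right-`KΓ`-invariant ON THE NOSE (weight law `F (g κ c) = τ(c)⁻¹ F g` with `τ c = 1`; no theta theory);
  `exists_mem_adelicThetaSpanSat_coe_eq_comp` — every element of the `KΓ`-saturated classical theta space `thetaSpaceSatOf` of a
  level is the archimedean restriction `F ∘ ιinf` of such an `F`;
* `adelicThetaRepHom e he 𝓕 : Representation ℂ Gf (adelicThetaSpan …)` — the representation pulled back along any
  homomorphism `e : Gf →* G_U(𝔸)` whose image centralises `ιinf (G₁)`; `adelicThetaRepHom_apply_eq_self` — saturated forms are
  FIXED by every `g` with `e g ∈ KΓ`.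
§2 (regime model of `V`): **`finToG V hV : V.adelicFin →* G_U(𝔸)`**, `k_f ↦ regimeEquiv (e⁻¹(1, k_f))` (= `toLatticeModelG V (1, k_f)`),
  lands in `archFinOf V`, in `satLevelRegimeOf V hV K` for `k_f ∈ K`, in `S.Gfin` and commutes with `S.ιinf` for ANY `S : ThetaAdelicSide V c`.
§3 **`S.adelicThetaRepFin hV k κ₁ τ₁ 𝓕 : Representation ℂ ↥V.adelicFin (adelicThetaSpan (S.P k) S.ιinf κ₁ τ₁ 𝓕)`** — the slot's
  adèlic theta module AS A `U(V)(𝔸_f)`-REPRESENTATION (so `(…).asModule` is a `MonoidAlgebra ℂ ↥V.adelicFin`-module, the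
  (J4-dict) candidate for the dictionary's `Ω`), and **`S.adelicThetaRepFin_apply_eq_self_of_mem`**: a form saturated at
  `satLevelRegimeOf V hV K` is fixed by every `k_f ∈ K`.
§4 AT THE PIN, in the regime: **`exists_fixed_adelic_lift_of_mem_thetaOf`** — every theta class `ω ∈ Θ_k(Γ)` of the END STATE
  (`thetaOf … (thetaSpaceInputOf … S) V c k Γ`) is a `(1,0)`-class whose harmonic pull-back is the archimedean restriction
  `F ∘ S.ιinf` of an element `F` of the slot's adèlic theta module which is saturated at `satLevelRegimeOf V h Γ.K`, hence FIXED by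
  `Γ.K` under `adelicThetaRepFin` — the (J4) half of the junction's `hIso` (the (J2) half, the tower class of `F` and its `res`, is
  binder-1's `TowerLevel`/`TowerCarrier`; the `ℂ[G]`-linear packaging is `Binders/EquivariantLift`).
KERNEL only: 0 records, 0 `def … : Prop`, nothing cited; `#print axioms` ⊆ {propext, Classical.choice, Quot.sound}.
-/

noncomputable section

open MeasureTheory NumberField NumberField.mixedEmbedding IsDedekindDomain
open Literature.NumberTheory.Automorphic Literature.NumberTheory.Weil1964
open Literature.NumberTheory.Automorphic.WeightForms (restrictHom thetaClasses IsLevelCorrected IsWeightMatched)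
open Literature.Geometry.ComplexHyperbolic.BallModel (U21)
open Literature.AlgebraicGeometry.HodgeTheory Literature.NumberTheory.Automorphic.PicardCM
open HodgeCM.PerL34.Seesaw HodgeCM.PerL34.RationalCoset HodgeCM.PerL34.SupplyAdelic
open HodgeCM.Model.SupplyInstance HodgeCM.Model.SupplyResidual

namespace HodgeCM
namespace Model

/-! ## §1. Character decomposition, saturated sub-span, pulled-back representation (any pair datum) -/

namespace ThetaSpace

section Generic

variable {K L : Type} [Field K] [NumberField K] [Field L] [NumberField L] [Algebra K L] [FiniteDimensional K L]
variable {J : Type} [Fintype J] {GU : Type} [Group GU] [TopologicalSpace GU] [IsTopologicalGroup GU]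
  [LocallyCompactSpace GU]
variable {P : WeilPairData K L J GU} [CompactSpace (GU ⧸ P.ΓU)]
variable {G₁ K₁ W : Type} [Group G₁] [Group K₁] [AddCommGroup W] [Module ℂ W] [Module.IsReflexive ℂ W]
variable {ιinf : G₁ →* GU} {Δ : Subgroup G₁} {κ₁ : K₁ →* G₁} {τ₁ : Representation ℂ K₁ W}
variable {𝓕 𝓕' : Set C(NumberField.relNormOneIdeles K L ⧸ NumberField.relNormOneRat K L, ℂ)}

/-- The theta forms of a situation with weight functions in `𝓕` lie in the sum over `f ∈ 𝓕` of the single-weight-function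
spaces (each generating theta form `θ(j, f)` has ONE weight function). -/
theorem KTypeSituation.thetaForms_le_biSup_singleton (S : KTypeSituation P ιinf Δ κ₁ τ₁)
    (𝓕 : Set C(NumberField.relNormOneIdeles K L ⧸ NumberField.relNormOneRat K L, ℂ)) :
    S.thetaForms 𝓕 ≤ ⨆ f ∈ 𝓕, S.thetaForms {f} := by
  unfold KTypeSituation.thetaForms ThetaKernelDatum.thetaForms
  refine Submodule.span_le.2 ?_
  rintro F ⟨j, hj, f, hf, rfl⟩
  refine Submodule.mem_iSup_of_mem f (Submodule.mem_iSup_of_mem hf ?_)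
  exact Submodule.subset_span ⟨j, hj, f, Set.mem_singleton f, rfl⟩

/-- Monotonicity of a situation's theta forms in the set of weight functions. -/
theorem KTypeSituation.thetaForms_mono (S : KTypeSituation P ιinf Δ κ₁ τ₁) (h : 𝓕' ⊆ 𝓕) :
    S.thetaForms 𝓕' ≤ S.thetaForms 𝓕 := by
  unfold KTypeSituation.thetaForms ThetaKernelDatum.thetaForms
  exact Submodule.span_mono fun _ ⟨j, hj, f, hf, e⟩ => ⟨j, hj, f, h hf, e⟩

/-- **Monotonicity of the adèlic theta module in the weight functions.** -/
theorem adelicThetaSpan_mono (h : 𝓕' ⊆ 𝓕) : adelicThetaSpan P ιinf κ₁ τ₁ 𝓕' ≤ adelicThetaSpan P ιinf κ₁ τ₁ 𝓕 :=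
  iSup_mono fun S => Submodule.map_mono (S.1.thetaForms_mono h)

/-- **Character decomposition**: the adèlic theta module with weight functions `𝓕` lies in (hence equals) the sum of the
single-character modules `adelicThetaSpan … {f}`, `f ∈ 𝓕` — in [Liu21]'s bookkeeping, one oscillator triple `(μ, ε, χ)` per
character `χ`. -/
theorem adelicThetaSpan_le_biSup_singleton :
    adelicThetaSpan P ιinf κ₁ τ₁ 𝓕 ≤ ⨆ f ∈ 𝓕, adelicThetaSpan P ιinf κ₁ τ₁ {f} := by
  refine iSup_le fun S => ?_
  refine (Submodule.map_mono (S.1.thetaForms_le_biSup_singleton 𝓕)).trans ?_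
  rw [Submodule.map_iSup]
  refine iSup_le fun f => ?_
  rw [Submodule.map_iSup]
  refine iSup_le fun hf => ?_
  exact (le_iSup_of_le S le_rfl :
      (S.1.thetaForms {f}).map (weightForms P.ΓU S.1.κ S.1.τ).subtype ≤ adelicThetaSpan P ιinf κ₁ τ₁ {f}).trans
    (le_iSup_of_le f (le_iSup_of_le hf le_rfl))

/-- The character decomposition as an equality. -/
theorem biSup_adelicThetaSpan_singleton_eq :
    ⨆ f ∈ 𝓕, adelicThetaSpan P ιinf κ₁ τ₁ {f} = adelicThetaSpan P ιinf κ₁ τ₁ 𝓕 :=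
  le_antisymm (iSup_le fun _ => iSup_le fun hf => adelicThetaSpan_mono (Set.singleton_subset_iff.2 hf))
    adelicThetaSpan_le_biSup_singleton

variable (P ιinf κ₁ τ₁) in
/-- **The `KΓ`-saturated adèlic theta module**: the span, in `GU → W`, of the adèlic theta forms of the strict situations
SATURATED at `KΓ ≤ G_U(𝔸)` (every element of `KΓ` is an index element with trivial weight), read at level `⊥`. -/
def adelicThetaSpanSat (KΓ : Subgroup GU) (𝓕 : Set C(NumberField.relNormOneIdeles K L ⧸ NumberField.relNormOneRat K L, ℂ)) :
    Submodule ℂ (GU → W) :=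
  ⨆ S : {S : KTypeSituation P ιinf (⊥ : Subgroup G₁) κ₁ τ₁ // S.IsSaturated KΓ ∧ S.IsStrict},
    (S.1.thetaForms 𝓕).map (weightForms P.ΓU S.1.κ S.1.τ).subtype

variable {KΓ KΓ' : Subgroup GU}

/-- The theta forms of a strict situation (any level) saturated at `KΓ` lie in the `KΓ`-saturated module. -/
theorem thetaForms_map_subtype_le_adelicThetaSpanSat (S : KTypeSituation P ιinf Δ κ₁ τ₁) (hsat : S.IsSaturated KΓ)
    (hS : S.IsStrict) :
    (S.thetaForms 𝓕).map (weightForms P.ΓU S.κ S.τ).subtype ≤ adelicThetaSpanSat P ιinf κ₁ τ₁ KΓ 𝓕 :=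
  le_iSup_of_le ⟨S.ofLE bot_le, hsat.ofLE bot_le, hS.ofLE bot_le⟩ le_rfl

/-- A single theta form of a saturated strict situation lies in the saturated module. -/
theorem coe_mem_adelicThetaSpanSat (S : KTypeSituation P ιinf Δ κ₁ τ₁) (hsat : S.IsSaturated KΓ) (hS : S.IsStrict)
    {θ : weightForms P.ΓU S.κ S.τ} (hθ : θ ∈ S.thetaForms 𝓕) :
    (θ : GU → W) ∈ adelicThetaSpanSat P ιinf κ₁ τ₁ KΓ 𝓕 :=
  thetaForms_map_subtype_le_adelicThetaSpanSat S hsat hS ⟨θ, hθ, rfl⟩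

/-- Saturated forms are forms: `adelicThetaSpanSat KΓ 𝓕 ≤ adelicThetaSpan 𝓕`. -/
theorem adelicThetaSpanSat_le_adelicThetaSpan :
    adelicThetaSpanSat P ιinf κ₁ τ₁ KΓ 𝓕 ≤ adelicThetaSpan P ιinf κ₁ τ₁ 𝓕 :=
  iSup_le fun S => thetaForms_map_subtype_le_adelicThetaSpan S.1 S.2.2

/-- Antitonicity in the saturation index: a deeper `KΓ' ≤ KΓ` saturates more situations. -/
theorem adelicThetaSpanSat_anti (h : KΓ' ≤ KΓ) :
    adelicThetaSpanSat P ιinf κ₁ τ₁ KΓ 𝓕 ≤ adelicThetaSpanSat P ιinf κ₁ τ₁ KΓ' 𝓕 :=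
  iSup_le fun S => le_iSup_of_le ⟨S.1, S.2.1.anti h, S.2.2⟩ le_rfl

/-- At `KΓ = ⊥` saturation is no condition: the saturated module is the whole adèlic theta module. -/
theorem adelicThetaSpanSat_bot : adelicThetaSpanSat P ιinf κ₁ τ₁ ⊥ 𝓕 = adelicThetaSpan P ιinf κ₁ τ₁ 𝓕 :=
  le_antisymm adelicThetaSpanSat_le_adelicThetaSpan
    (iSup_le fun S => le_iSup_of_le ⟨S.1, S.1.isSaturated_bot, S.2⟩ le_rfl)

omit [TopologicalSpace GU] [IsTopologicalGroup GU] [LocallyCompactSpace GU] [Module.IsReflexive ℂ W] in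
/-- A weight form whose weight group saturates `KΓ` with trivial weight is right-`KΓ`-invariant:
`F (g k) = F (g κ c) = τ(c)⁻¹ F g = F g`. -/
theorem apply_mul_eq_of_isSaturated {Kc : Type} [Group Kc] {ΓU : Subgroup GU} {κ : Kc →* GU}
    {τ : Representation ℂ Kc W} {F : GU → W} (hF : F ∈ weightForms ΓU κ τ) (hsat : ∀ k ∈ KΓ, ∃ c : Kc, κ c = k ∧ τ c = 1)
    {k : GU} (hk : k ∈ KΓ) (g : GU) : F (g * k) = F g := by
  obtain ⟨c, rfl, hτ⟩ := hsat k hk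
  have hinv : τ c⁻¹ = 1 := by
    calc τ c⁻¹ = τ c⁻¹ * τ c := by rw [hτ, mul_one]
      _ = 1 := by rw [← map_mul, inv_mul_cancel, map_one]
  rw [hF.2 c g, hinv, Module.End.one_apply]

/-- **Elements of the `KΓ`-saturated module are right-`KΓ`-invariant on the nose**: `R_k F = F` for `k ∈ KΓ`. -/
theorem rightShift_eq_self_of_mem_adelicThetaSpanSat {F : GU → W} (hF : F ∈ adelicThetaSpanSat P ιinf κ₁ τ₁ KΓ 𝓕)
    {k : GU} (hk : k ∈ KΓ) : rightShift k F = F := by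
  refine Submodule.iSup_induction _ (motive := fun F => rightShift (W := W) k F = F) hF ?_ ?_ ?_
  · rintro ⟨S, hsat, -⟩ F ⟨θ, -, rfl⟩
    funext g
    exact apply_mul_eq_of_isSaturated θ.2 hsat hk g
  · exact map_zero _
  · intro F F' hF hF'
    rw [map_add, hF, hF']

/-- Pointwise form: `F (g k) = F g` for `F` saturated at `KΓ` and `k ∈ KΓ`. -/
theorem apply_mul_eq_self_of_mem_adelicThetaSpanSat {F : GU → W} (hF : F ∈ adelicThetaSpanSat P ιinf κ₁ τ₁ KΓ 𝓕)
    {k : GU} (hk : k ∈ KΓ) (g : GU) : F (g * k) = F g := by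
  have := congrFun (rightShift_eq_self_of_mem_adelicThetaSpanSat hF hk) g
  rwa [rightShift_apply] at this

/-- **Every element of the `KΓ`-saturated classical theta space of level `Δ` is the archimedean restriction of an element of
the `KΓ`-saturated adèlic theta module** (saturated twin of `exists_mem_adelicThetaSpan_coe_eq_comp`). -/
theorem exists_mem_adelicThetaSpanSat_coe_eq_comp {f : weightForms Δ κ₁ τ₁}
    (hf : f ∈ thetaSpaceSatOf P ιinf Δ κ₁ τ₁ KΓ 𝓕) :
    ∃ F ∈ adelicThetaSpanSat P ιinf κ₁ τ₁ KΓ 𝓕, (f : G₁ → W) = F ∘ ιinf := by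
  refine Submodule.iSup_induction _
    (motive := fun f : weightForms Δ κ₁ τ₁ => ∃ F ∈ adelicThetaSpanSat P ιinf κ₁ τ₁ KΓ 𝓕, (f : G₁ → W) = F ∘ ιinf)
    hf ?_ ?_ ?_
  · rintro ⟨S, hsat, hstr⟩ f ⟨θ, hθ, rfl⟩
    exact ⟨θ, coe_mem_adelicThetaSpanSat S hsat hstr hθ, rfl⟩
  · exact ⟨0, Submodule.zero_mem _, rfl⟩
  · rintro f f' ⟨F, hF, hfe⟩ ⟨F', hF', hfe'⟩
    refine ⟨F + F', Submodule.add_mem _ hF hF', ?_⟩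
    rw [Submodule.coe_add, hfe, hfe']; rfl

/-- **The adèlic theta module as a representation of any group mapping to `G_U(𝔸)` with image centralising `ιinf (G₁)`**
(e.g. the finite-adèlic factor `U(V)(𝔸_f)`): `g ↦ R_{e g}`. -/
def adelicThetaRepHom {Gf : Type} [Group Gf] (e : Gf →* GU) (he : ∀ (g : Gf) (x : G₁), Commute (e g) (ιinf x))
    (𝓕 : Set C(NumberField.relNormOneIdeles K L ⧸ NumberField.relNormOneRat K L, ℂ)) :
    Representation ℂ Gf (adelicThetaSpan P ιinf κ₁ τ₁ 𝓕) where
  toFun g := (rightShift (e g)).restrict fun F hF => rightShift_mem_adelicThetaSpan (he g) hF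
  map_one' := by
    apply LinearMap.ext; intro F; apply Subtype.ext; funext g
    simp [LinearMap.restrict_apply]
  map_mul' g g' := by
    apply LinearMap.ext; intro F; apply Subtype.ext; funext x
    simp [LinearMap.restrict_apply, mul_assoc]

/-- (Ported verbatim from the HodgeCMPerL package; no docstring in the source.) -/
@[simp] theorem coe_adelicThetaRepHom_apply {Gf : Type} [Group Gf] (e : Gf →* GU)
    (he : ∀ (g : Gf) (x : G₁), Commute (e g) (ιinf x)) (g : Gf) (F : adelicThetaSpan P ιinf κ₁ τ₁ 𝓕) (x : GU) :
    (adelicThetaRepHom e he 𝓕 g F : GU → W) x = (F : GU → W) (x * e g) := rfl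

/-- **Saturated forms are fixed vectors**: if `F` is saturated at `KΓ` and `e g ∈ KΓ` then `g · F = F`. -/
theorem adelicThetaRepHom_apply_eq_self {Gf : Type} [Group Gf] (e : Gf →* GU)
    (he : ∀ (g : Gf) (x : G₁), Commute (e g) (ιinf x)) {F : adelicThetaSpan P ιinf κ₁ τ₁ 𝓕}
    (hF : (F : GU → W) ∈ adelicThetaSpanSat P ιinf κ₁ τ₁ KΓ 𝓕) {g : Gf} (hg : e g ∈ KΓ) :
    adelicThetaRepHom e he 𝓕 g F = F :=
  Subtype.ext (rightShift_eq_self_of_mem_adelicThetaSpanSat hF hg)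

/-- **A theta class of the `KΓ`-saturated classical theta space is the class of a saturated adèlic form** (classical
restriction situation `MonoidHom.id G₁`, any class-map datum `D₀`): the `(1,0)`-class `cl = ω`, its harmonic pull-back is
holomorphic and equals, as a function on `G₁`, the archimedean restriction `F ∘ ιinf` of some `F ∈ adelicThetaSpanSat … KΓ 𝓕`. -/
theorem exists_sat_lift_of_mem_thetaClasses {H : Type*} [AddCommGroup H] [Module ℂ H] {η₀ : K₁ →* K₁}
    {hΔ₀ : IsLevelCorrected Δ κ₁ τ₁ (MonoidHom.id G₁) Δ} {hη₀ : IsWeightMatched κ₁ τ₁ (MonoidHom.id G₁) κ₁ τ₁ η₀}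
    (D₀ : WeightForms.ClassMapDatum (MonoidHom.id G₁) hΔ₀ hη₀ H) {ω : H}
    (hω : ω ∈ thetaClasses (MonoidHom.id G₁) D₀ (thetaSpaceSatOf P ιinf Δ κ₁ τ₁ KΓ 𝓕)) :
    ∃ cl : D₀.H10, (cl : H) = ω ∧ D₀.pull cl ∈ D₀.Hol ∧
      ∃ F ∈ adelicThetaSpanSat P ιinf κ₁ τ₁ KΓ 𝓕, ((D₀.pull cl : weightForms Δ κ₁ τ₁) : G₁ → W) = F ∘ ιinf := by
  obtain ⟨cl, rfl, f, hf, hhol, hpull⟩ := hω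
  obtain ⟨F, hF, hfe⟩ := exists_mem_adelicThetaSpanSat_coe_eq_comp hf
  refine ⟨cl, rfl, ?_, F, hF, ?_⟩
  · rw [hpull]; exact hhol
  · rw [hpull]; exact hfe

end Generic

end ThetaSpace

/-! ## §2. The finite-adèlic factor `U(V)(𝔸_f) →* G_U(𝔸)` of the regime model -/

section Fin

variable {L : CMField} {ι₁ : L →+* ℂ} (V : HermSpace3 L ι₁)

/-- **The finite-adèlic factor of the regime model group**: `k_f ↦ regimeEquiv (e⁻¹(1, k_f)) ∈ G_U(𝔸)`, `e` the product
decomposition `U(V)(𝔸_{L⁺}) ≃ U(V)(L ⊗ ℝ) × U(V)(𝔸_{L⁺,f})` (anisotropic regime `hV`). -/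
def finToG (hV : IsAnisotropic L V.Hm) : V.adelicFin →* (V.latticeModel printFact_unitaryCompact_holds).G :=
  ((HodgeCM.Adelic.regimeEquiv L V.Hm hV).toMonoidHom.comp
    (UnitaryGroup.cmAdelicProdEquiv (L : Type) 3 V.Hm).symm.toMonoidHom).comp (MonoidHom.inr _ _)

/-- (Ported verbatim from the HodgeCMPerL package; no docstring in the source.) -/
theorem finToG_apply (hV : IsAnisotropic L V.Hm) (kf : V.adelicFin) :
    finToG V hV kf =
      HodgeCM.Adelic.regimeEquiv L V.Hm hV ((UnitaryGroup.cmAdelicProdEquiv (L : Type) 3 V.Hm).symm (1, kf)) := rfl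

/-- `e⁻¹(1, k_f)` is the finite-adèlic inclusion `(1, k_f)` of the tree. -/
theorem cmAdelicProdEquiv_symm_one (kf : V.adelicFin) :
    (UnitaryGroup.cmAdelicProdEquiv (L : Type) 3 V.Hm).symm (1, kf) =
      UnitaryGroup.finAdelicToAdelic (↥(maximalRealSubfield L)) (L : Type) (IsCMField.complexConj L) 3 V.Hm kf := by
  show (UnitaryGroup.adelicProdEquiv _ _ _ _ _).symm (1, kf) = _
  rw [UnitaryGroup.adelicProdEquiv_symm_apply, map_one, one_mul]

/-- `finToG` in period-1's currency: `finToG V hV k_f = toLatticeModelG V (1, k_f)`. -/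
theorem finToG_eq_toLatticeModelG (hV : IsAnisotropic L V.Hm) (kf : V.adelicFin) :
    finToG V hV kf = toLatticeModelG V
      (UnitaryGroup.finAdelicToAdelic (↥(maximalRealSubfield L)) (L : Type) (IsCMField.complexConj L) 3 V.Hm kf) := by
  rw [finToG_apply, cmAdelicProdEquiv_symm_one, toLatticeModelG_apply, Adelic.toRegime_apply_of L V.Hm hV]
  rfl

/-- The finite-adèlic factor lies in the away-from-`ι₁` factor `archFinOf V`. -/
theorem finToG_mem_archFinOf (hV : IsAnisotropic L V.Hm) (kf : V.adelicFin) : finToG V hV kf ∈ archFinOf V := by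
  rw [finToG_apply]
  exact finAdelic_mem_archFinOf V hV kf

/-- The finite-adèlic factor commutes with period-1's archimedean component `archInfOf V`. -/
theorem commute_finToG_archInfOf (hV : IsAnisotropic L V.Hm) (kf : V.adelicFin) (x : U21) :
    Commute (finToG V hV kf) (archInfOf V x) :=
  commute_archFinOf_archInfOf V x _ (finToG_mem_archFinOf V hV kf)

/-- **`k_f ∈ K ⇒ finToG V hV k_f ∈ satLevelRegimeOf V hV K`**: the finite level sits inside its own saturation subgroup. -/
theorem finToG_mem_satLevelRegimeOf (hV : IsAnisotropic L V.Hm) {K : Subgroup V.adelicFin} {kf : V.adelicFin}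
    (hk : kf ∈ K) : finToG V hV kf ∈ satLevelRegimeOf V hV K := by
  rw [finToG_eq_toLatticeModelG]
  refine toLatticeModelG_mem_satLevelRegimeOf V hV K ?_
  rw [← awayLevelCM_eq_satLevelOf]
  refine (UnitaryGroup.mem_awayLevelCM_iff _ _ _ _ _ _).2 ⟨?_, ?_⟩
  · exact UnitaryGroup.finAdelicToAdelic_mem_awayFrom (↥(maximalRealSubfield L)) (L : Type) (IsCMField.complexConj L) 3
      V.Hm (IsCMField.complexConj_ne_one L) (complexConj_smul_infinitePlace L) (UnitaryGroup.cmPlace (L : Type) ι₁) kf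
  · rw [UnitaryGroup.finPart_finAdelicToAdelic]
    exact hk

namespace ThetaAdelicSide

variable {V} {c : SeesawCtx L} (S : ThetaAdelicSide V c)

/-- For ANY adelic side `S`, the finite-adèlic factor lies in `S.Gfin` (pin field `fin_mem_Gfin`, at `k_f⁻¹`). -/
theorem finToG_mem_Gfin (hV : IsAnisotropic L V.Hm) (kf : V.adelicFin) : finToG V hV kf ∈ S.Gfin := by
  have h := S.fin_mem_Gfin hV kf⁻¹
  rwa [inv_inv] at h

/-- For ANY adelic side `S`, the finite-adèlic factor commutes with the archimedean component `S.ιinf` (pin field `comm_fin`). -/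
theorem commute_finToG_ιinf (hV : IsAnisotropic L V.Hm) (kf : V.adelicFin) (x : U21) :
    Commute (finToG V hV kf) (S.ιinf x) :=
  S.comm_fin x _ (S.finToG_mem_Gfin hV kf)

end ThetaAdelicSide

end Fin

/-! ## §3. The slot's adèlic theta module as a `U(V)(𝔸_f)`-representation; level-`K` forms are `K`-fixed -/

namespace ThetaAdelicSide

open ThetaSpace

variable {L : CMField} {ι₁ : L →+* ℂ} {V : HermSpace3 L ι₁} {c : SeesawCtx L} (S : ThetaAdelicSide V c)
variable {K₁ W : Type} [Group K₁] [AddCommGroup W] [Module ℂ W] [Module.IsReflexive ℂ W]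

/-- **The adèlic theta module of slot `k` as a representation of `U(V)(𝔸_{L⁺,f}) = ↥V.adelicFin`** (archimedean `K`-type data
`(κ₁, τ₁)`, weight functions `𝓕`): right translation through the finite-adèlic factor `finToG`.  Its `asModule` is the
`MonoidAlgebra ℂ ↥V.adelicFin`-module the (J3) dictionary's `Ω` wants for the triples of the slot. -/
def adelicThetaRepFin (hV : IsAnisotropic L V.Hm) (k : Fin 4) (κ₁ : K₁ →* U21) (τ₁ : Representation ℂ K₁ W)
    (𝓕 : Set C(NumberField.relNormOneIdeles (↥(maximalRealSubfield L)) L ⧸ NumberField.relNormOneRat (↥(maximalRealSubfield L)) L, ℂ)) :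
    Representation ℂ V.adelicFin (adelicThetaSpan (S.P k) S.ιinf κ₁ τ₁ 𝓕) :=
  adelicThetaRepHom (finToG V hV) (S.commute_finToG_ιinf hV) 𝓕

variable {κ₁ : K₁ →* U21} {τ₁ : Representation ℂ K₁ W}
  {𝓕 : Set C(NumberField.relNormOneIdeles (↥(maximalRealSubfield L)) L ⧸ NumberField.relNormOneRat (↥(maximalRealSubfield L)) L, ℂ)}

/-- (Ported verbatim from the HodgeCMPerL package; no docstring in the source.) -/
@[simp] theorem coe_adelicThetaRepFin_apply (hV : IsAnisotropic L V.Hm) (k : Fin 4) (kf : V.adelicFin)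
    (F : adelicThetaSpan (S.P k) S.ιinf κ₁ τ₁ 𝓕) (x : (V.latticeModel printFact_unitaryCompact_holds).G) :
    (S.adelicThetaRepFin hV k κ₁ τ₁ 𝓕 kf F : _ → W) x = (F : _ → W) (x * finToG V hV kf) := rfl

/-- **Level-`K` theta forms are `K`-fixed vectors**: an element of the slot's module saturated at `satLevelRegimeOf V hV K`
is fixed by every `k_f ∈ K`. -/
theorem adelicThetaRepFin_apply_eq_self_of_mem (hV : IsAnisotropic L V.Hm) (k : Fin 4) {K : Subgroup V.adelicFin}
    {F : adelicThetaSpan (S.P k) S.ιinf κ₁ τ₁ 𝓕}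
    (hF : (F : _ → W) ∈ adelicThetaSpanSat (S.P k) S.ιinf κ₁ τ₁ (satLevelRegimeOf V hV K) 𝓕)
    {kf : V.adelicFin} (hk : kf ∈ K) : S.adelicThetaRepFin hV k κ₁ τ₁ 𝓕 kf F = F :=
  adelicThetaRepHom_apply_eq_self _ _ hF (finToG_mem_satLevelRegimeOf V hV hk)

end ThetaAdelicSide

/-! ## §4. At the pin: every theta class of the END STATE is the class of a `Γ.K`-fixed adèlic theta form -/

section Pin

open ThetaSpace MulAction
open Literature.Geometry.ComplexHyperbolic.BallModel (x₀)
open Literature.AlgebraicGeometry.ShimuraVarieties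

variable (hHD : exists_isReal_hodgeModel) (hI : hodgePQ_independent_of_hodgeModel)
  (h₁ : BallQuotientUniformised) (h₃ : CMAbelianVarietyRealised)
variable (S : ∀ {L : CMField} {ι₁ : L →+* ℂ} (V : HermSpace3 L ι₁) (c : SeesawCtx L), ThetaAdelicSide V c)
variable {L : CMField} {ι₁ : L →+* ℂ}


-- port_pkg: scope closed for this part
end Pin
end Model
end HodgeCM
end
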